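import Summits.Ventures.CertifiedManyBodySolver.Observables.MeanFieldClassExclusionObjectEYbco106
import Literature.MathematicalPhysics.QuantumLattice.HubbardFermiSeaTangentRowsDeepColumns
import Literature.MathematicalPhysics.QuantumLattice.HubbardFermiSeaTangentRowsBoxEnds
import Literature.MathematicalPhysics.QuantumLattice.HubbardFermiSeaTangentRowsLow
import Literature.MathematicalPhysics.QuantumLattice.HubbardFermiSeaTangentRowsLowB
import Literature.MathematicalPhysics.QuantumLattice.HubbardFermiSeaTangentRowsLscoColumns
import Summits.Ventures.CertifiedManyBodySolver.Observables.MeanFieldClassExclusionPolarisedCapHg1201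
import Summits.Ventures.CertifiedManyBodySolver.Certificates.HubbardSquare_afhfCap_n1_U5
import Summits.Ventures.CertifiedManyBodySolver.Certificates.HubbardSquare_afhfCap_n1_U6
import Summits.Ventures.CertifiedManyBodySolver.Certificates.HubbardSquare_afhfCap_n1_U7
import HarnessLib

/-!
# Ventures/CertifiedManyBodySolver — Observables/MeanFieldClassExclusionPolarisedCapV2Hg1201.lean

HONEST FRAMING: first certified bounds; not a superconductivity verdict; every number certified or labelled float.
A competing-order EXCLUSION removes a named class of candidate ground states; it never says which order is present;
no phase sentence follows.

Cell `hubbard-tc` (MO-S3, D-0096), seat `hubbard-tc-mod-3` (G3: competing orders as exclusion inputs from certified energy ORDERINGS),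
`prover-hubbard-tc-mod-3-g6-0`. **UNCONDITIONAL EDITIONS, round 2 (`_v2`: polarised-sea ∧ AF-Hartree–Fock caps)** of the registry's MF/BCS-class exclusion words on the HgBa₂CuO₄₊δ object-E boxes (M19b, M19 `[3.5, 8.8] × [−0.54, −0.43]`; p = 0.16 @ 10 GPa `[3.0, 8.5] × [−0.49, −0.35]`).
The earlier words (`MeanFieldClassExclusionObjectE{,2,Hg,Hg1223,Tl2201}.lean`, `…LaLowU(B).lean`, …) take mbsolver claim nodes (#445, #473, #472, #498,
#21) as hypotheses because their CAPS are transported certified anchors. Round 1 (`…PolarisedCap*.lean`) capped with the fully POLARISED one-species grid-cell Fermi sea — a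
`U`-independent Slater determinant whose energy plane `e₀(1, s, U, n_j) ≤ A_j + s·B_j` is certified IN THE KERNEL by the tree's
`TTPrimeFree.polarizedPlaneCheck` (file `HubbardTTPrimePolarizedSeaCapTable`, the device behind hubbard-box-p2's sandwich words; `M = 40`, interval
enclosures of the cell-averaged cosines, `decide +kernel`). On hole-doped faces with `t' ≲ −0.2` this cap lies `0.2–0.4·t` BELOW the transported
anchors, so the docc tail closes at the Stoner-type threshold `U₁ = (e_pol − e_free)/(n/2)²` — LOWER than before — and WITHOUT any claim node:
a non-magnetic Hartree–Fock / singlet-BCS state has energy `≥ e_free + U(n/2)²` (Wick; Bach–Lieb–Solovej 1994 §2), the ground state has energy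
`≤ e_pol` at every `U`, and concavity in `U` gives `docc_GS ≤ (e_pol − e_free)/U`.

Every word: for the stated `t'`-range (⊇ the S1 box of record), EVERY `U ≥ U₁` and the stated filling band (⊇ the box band, ends on the
`1/1600` grid of the certificate), every torus limit `ω` of unit `(rectN n L, S^z = 0)`-sector ground states of `hubbardTorusTT' L 1 t' U` has
`Re ω(n_{0↑} n_{0↓}) < (n/2)²` (the identification «no HF/BCS ground state» is the docstring's reading; the THEOREM is the strict docc inequality):

* `hgP_M19b_docc_lt_v2` — HgBa₂CuO₄₊δ p = ⅛ (VSET M19b), per-column object-E box `[3.5, 8.8] × [−0.54, −0.43] × [0.835, 0.915]`: `t' ∈ [-27/50, -43/100]` × `n ∈ [167/200, 183/200]`, EVERY `U ≥ 5` (box `[3.5, 8.8]`; before: `hgP_M19b_docc_lt (round 1) ⊂ hgE_p0125_docc_lt_of / hgE_p0125_deep_docc_lt_of (U ≥ 6 / 6.5; #445 ∧ #473 ∧ #472)`);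
* `hgP_M19_docc_lt_v2` — HgBa₂CuO₄₊δ optimal p = 0.16 (VSET M19), object-E box `[3.5, 8.8] × [−0.54, −0.43] × [0.80, 0.88]`: `t' ∈ [-27/50, -43/100]` × `n ∈ [4/5, 22/25]`, EVERY `U ≥ 47/10` (box `[3.5, 8.8]`; before: `hgP_M19_docc_lt (round 1) ⊂ hgE_p016_docc_lt_of / hgE_p016_deep_docc_lt_of (U ≥ 6.4 / 7; #445 ∧ #473 ∧ #472)`);
* `hgP_M19P10_docc_lt_v2` — HgBa₂CuO₄₊δ p = 0.16 at P = 10 GPa (first pressure column), object-E box `[3.0, 8.5] × [−0.49, −0.35] × [0.79, 0.88]`: `t' ∈ [-49/100, -7/20]` × `n ∈ [79/100, 22/25]`, EVERY `U ≥ 49/10` (box `[3.0, 8.5]`; before: `hgP_M19P10_docc_lt (round 1) ⊂ hgE_P10_p016_docc_lt_of (U ≥ 6.5; #445 ∧ #473 ∧ #472)`);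

Round 2 adds hubbard-box-p2's KERNEL-CHECKED antiferromagnetic Hartree–Fock cap planes at HALF FILLING (`afhfCap_n1_U5/U6/U7_at`: `e₀(1, t', U, 1) ≤ C_{U_c}` for every `t'` and every `U ≤ U_c`, `QFK.Cert` certificates, no hypothesis): the density chord from the polarised plane at the band's LOWER end to the AF-HF cap at `n = 1` (or, next to half filling, the vacuum chord `n·C_{U_c}`) is a far lower cap at the band's TOP than the polarised plane there, and the tail runs with `U_c ∈ {5, 6, 7}` (cap monotone in `U` below `U_c`, Hartree–Fock Lipschitz slope `(n/2)²` above — `doccN_lt_of_capUc_threshold`; thresholds `≤ U_c` by construction). Proof otherwise as round 1: CAP chord (`objE_capChord_mul`, convexity in `n`); FLOOR = kernel Fermi-sea tangent rows (cell-exact,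
`HubbardFermiSeaTangentRows*`) at columns bracketing the box, read between columns by the `t'`-chord (`objE_floorChord_mul`, concavity in `t'`);
TAIL = `doccN_lt_of_capUc_threshold` with `U_c := U`; `(n/2)²` above its tangent at the band's lower end. Cap chord, floor chord and tangent are
bilinear in `(n, t')`: one `nlinarith` leaf per column piece with the four McCormick products of its rectangle (corner-exact). Exact margins
(designer `hubbard-tc-mod-3/g6-replay/editions/`, exact rationals on the tree constants) are printed in each docstring; binding corners sit at the
TOP filling and the SHALLOW `t'` end (the polarisation cost grows with `n` and toward `t' = 0`). The conditional words remain true and cited; these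
editions supersede them for box coverage. NEW COVERAGE: M19b from 5.0 (round 1: 5.9), M19 from 4.7 (5.5), @10 GPa from 4.9 (5.6).
WHAT THIS IS NOT: a statement about stripes/CDW, d-wave order or T_c; a claim that the ground state is polarised anywhere; tight; a phase word.

References: Bach–Lieb–Solovej, J. Stat. Phys. 76 (1994) 3, eq. (2c.36) [BachLiebSolovej1994]; Koma–Tasaki, J. Stat. Phys. 76 (1994) 745, §1 [KomaTasaki1994];
Lieb–Loss, Duke Math. J. 71 (1993) 337, §8 Thm 8.2 [LiebLoss1993]; Israel (1979) Thm I.3.4 [Israel1979]; Ruelle (1969) §3.3 [Ruelle1969]; Neumaier, Acta Numerica 13 (2004) §11 [Neumaier2004CompleteSearch].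
-/

noncomputable section

namespace Summit.Ventures.CertifiedManyBodySolver.Observables

open Literature.MathematicalPhysics.QuantumLattice
open Literature.MathematicalPhysics.QuantumLattice.ThermodynamicLimit
open Literature.MathematicalPhysics.QuantumLattice.TTPrimeFree
open Summit.Ventures.CertifiedManyBodySolver.Certificates
open Matrix HubbardWave0 Literature.Probability.LatticeModels Filter Topology Set
open scoped ComplexOrder BigOperators

/-! ### §1 (no new certificates: the polarised-sea planes of round 1 are imported; the AF-Hartree–Fock half-filling caps are hubbard-box-p2's `afhfCap_n1_U5/U6/U7_at`) -/
/-! ### §2 The words (cap chord in `n`, floor chords in `t'`, one McCormick leaf per column piece; tail with `U_c := U`) -/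
/-- **HgBa₂CuO₄₊δ p = ⅛ (VSET M19b), per-column object-E box `[3.5, 8.8] × [−0.54, −0.43] × [0.835, 0.915]`, `t' ∈ [-27/50, -43/100]` × `n ∈ [167/200, 183/200]` — MF/BCS class excluded at EVERY `U ≥ 5`, HYPOTHESIS-FREE** (box `U/t_eff ∈ [3.5, 8.8]`; supersedes for coverage the conditional `hgP_M19b_docc_lt (round 1) ⊂ hgE_p0125_docc_lt_of / hgE_p0125_deep_docc_lt_of (U ≥ 6 / 6.5; #445 ∧ #473 ∧ #472)`). Every GS torus limit has `Re ω(n_{0↑}n_{0↓}) < (n/2)²`. Cap at `U_c = 5` = density chord from the polarised-sea plane at `n = 167/200` to the kernel AF-HF half-filling cap `afhfCap_n1_U5_at` (tail: monotone below `U_c`, HF slope above); floor = `t'`-chords of the kernel Fermi-sea columns `-113/200 | -1/2 | -43/100` (touch `9/10 | 9/10 | 9/10`); exact piece margins `+0.0270`, `+0.0081`. [cite: BachLiebSolovej1994, eq. (2c.36)] [cite: KomaTasaki1994, §1] [cite: LiebLoss1993, §8, Theorem 8.2] -/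
theorem hgP_M19b_docc_lt_v2 {t' U n : ℝ} (ht1 : -27 / 50 ≤ t') (ht2 : t' ≤ -43 / 100) (hU : 5 ≤ U)
    (hn1 : 167 / 200 ≤ n) (hn2 : n ≤ 183 / 200) :
    ∀ (ω : InfVolFermionState 2) (Ls : ℕ → ℕ) (ψ : ∀ L, Fock (Orb (FermionTorus 2 L))),
      Tendsto Ls atTop atTop →
      (∀ j, IsGroundStateInSector (hubbardTorusTT' (Ls j) 1 t' U) (rectN n (Ls j)) 0 (ψ (Ls j))) →
      (∀ j, star (ψ (Ls j)) ⬝ᵥ ψ (Ls j) = 1) → ω.IsTorusLimitOf ψ Ls →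
      (ω.expect ({0} : Finset (Site 2))
        (nAt 0 (Finset.mem_singleton_self 0) 0 * nAt 0 (Finset.mem_singleton_self 0) 1)).re < (n / 2) ^ 2 := by
  have hn0 : (0 : ℝ) ≤ n := by linarith
  have hn2' : n < 2 := by linarith
  have hsq : (-27889 / 160000 : ℝ) + 167 / 400 * n ≤ (n / 2) ^ 2 := by nlinarith [sq_nonneg (n - 167 / 200)]
  have hsqU : ((-27889 / 160000 : ℝ) + 167 / 400 * n) * (5) ≤ (n / 2) ^ 2 * (5) :=
    mul_le_mul_of_nonneg_right hsq (by norm_num)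
  -- CAP at `U_c = 5`: density chord from the polarised-sea plane at `n = 167/200` to the kernel AF-Hartree–Fock half-filling cap
  have ca := hgP19b_polCap_n8350 (by norm_num : (0 : ℝ) ≤ 5) ht1 ht2
  have cb := afhfCap_n1_U5_at t' (by norm_num : (0 : ℝ) ≤ 5) le_rfl
  have hcap := objE_capChord_mul (k := 200 / 33) (by norm_num : (0 : ℝ) ≤ 5) (by norm_num) (by norm_num) (by norm_num) ca cb hn1 (by linarith) (by norm_num)
  rcases le_or_gt t' (-1 / 2) with hp0 | hp0
  · -- piece `[-27/50, -1/2]`, columns `-113/200`, `-1/2`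
    have ra := fermiSeaRow4_tPrime_neg_hundredthirteen_div_twohundred_at_nine_div_ten (U := 0) le_rfl hn0 hn2'
    have rb := fermiSeaTangentRow_tPrime_neg_one_div_two_at_nine_div_ten (U := 0) le_rfl hn0 hn2'
    have hfl := objE_floorChord_mul (s := t') (k := 200 / 13) hn0 hn2' (by norm_num : (-113 / 200 : ℝ) < -1 / 2) ra rb (by linarith) hp0 (by norm_num)
    exact doccN_lt_of_capUc_threshold (U₁ := 5) (Uc := 5) (by norm_num) (by norm_num) hU hn0 hn2' hcap hfl
      (by nlinarith only [mul_nonneg (sub_nonneg.2 hn1) (sub_nonneg.2 ht1), mul_nonneg (sub_nonneg.2 hn1) (sub_nonneg.2 hp0), mul_nonneg (sub_nonneg.2 hn2) (sub_nonneg.2 ht1), mul_nonneg (sub_nonneg.2 hn2) (sub_nonneg.2 hp0), hsqU])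
  · -- `t' > -1/2`
    have ra := fermiSeaTangentRow_tPrime_neg_one_div_two_at_nine_div_ten (U := 0) le_rfl hn0 hn2'
    have rb := fermiSeaTangentRow_tPrime_neg_fortythree_div_hundred_at_nine_div_ten (U := 0) le_rfl hn0 hn2'
    have hfl := objE_floorChord_mul (s := t') (k := 100 / 7) hn0 hn2' (by norm_num : (-1 / 2 : ℝ) < -43 / 100) ra rb hp0.le ht2 (by norm_num)
    exact doccN_lt_of_capUc_threshold (U₁ := 5) (Uc := 5) (by norm_num) (by norm_num) hU hn0 hn2' hcap hfl
      (by nlinarith only [mul_nonneg (sub_nonneg.2 hn1) (sub_nonneg.2 hp0.le), mul_nonneg (sub_nonneg.2 hn1) (sub_nonneg.2 ht2), mul_nonneg (sub_nonneg.2 hn2) (sub_nonneg.2 hp0.le), mul_nonneg (sub_nonneg.2 hn2) (sub_nonneg.2 ht2), hsqU])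

/-- **HgBa₂CuO₄₊δ optimal p = 0.16 (VSET M19), object-E box `[3.5, 8.8] × [−0.54, −0.43] × [0.80, 0.88]`, `t' ∈ [-27/50, -43/100]` × `n ∈ [4/5, 22/25]` — MF/BCS class excluded at EVERY `U ≥ 47/10`, HYPOTHESIS-FREE** (box `U/t_eff ∈ [3.5, 8.8]`; supersedes for coverage the conditional `hgP_M19_docc_lt (round 1) ⊂ hgE_p016_docc_lt_of / hgE_p016_deep_docc_lt_of (U ≥ 6.4 / 7; #445 ∧ #473 ∧ #472)`). Every GS torus limit has `Re ω(n_{0↑}n_{0↓}) < (n/2)²`. Cap at `U_c = 5` = density chord from the polarised-sea plane at `n = 4/5` to the kernel AF-HF half-filling cap `afhfCap_n1_U5_at` (tail: monotone below `U_c`, HF slope above); floor = `t'`-chords of the kernel Fermi-sea columns `-113/200 | -1/2 | -2/5` (touch `33/40 | 7/8 | 7/8`); exact piece margins `+0.0374`, `+0.0123`. [cite: BachLiebSolovej1994, eq. (2c.36)] [cite: KomaTasaki1994, §1] [cite: LiebLoss1993, §8, Theorem 8.2] -/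
theorem hgP_M19_docc_lt_v2 {t' U n : ℝ} (ht1 : -27 / 50 ≤ t') (ht2 : t' ≤ -43 / 100) (hU : 47 / 10 ≤ U)
    (hn1 : 4 / 5 ≤ n) (hn2 : n ≤ 22 / 25) :
    ∀ (ω : InfVolFermionState 2) (Ls : ℕ → ℕ) (ψ : ∀ L, Fock (Orb (FermionTorus 2 L))),
      Tendsto Ls atTop atTop →
      (∀ j, IsGroundStateInSector (hubbardTorusTT' (Ls j) 1 t' U) (rectN n (Ls j)) 0 (ψ (Ls j))) →
      (∀ j, star (ψ (Ls j)) ⬝ᵥ ψ (Ls j) = 1) → ω.IsTorusLimitOf ψ Ls →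
      (ω.expect ({0} : Finset (Site 2))
        (nAt 0 (Finset.mem_singleton_self 0) 0 * nAt 0 (Finset.mem_singleton_self 0) 1)).re < (n / 2) ^ 2 := by
  have hn0 : (0 : ℝ) ≤ n := by linarith
  have hn2' : n < 2 := by linarith
  have hsq : (-4 / 25 : ℝ) + 2 / 5 * n ≤ (n / 2) ^ 2 := by nlinarith [sq_nonneg (n - 4 / 5)]
  have hsqU : ((-4 / 25 : ℝ) + 2 / 5 * n) * (47 / 10) ≤ (n / 2) ^ 2 * (47 / 10) :=
    mul_le_mul_of_nonneg_right hsq (by norm_num)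
  -- CAP at `U_c = 5`: density chord from the polarised-sea plane at `n = 4/5` to the kernel AF-Hartree–Fock half-filling cap
  have ca := hgP19_polCap_n8000 (by norm_num : (0 : ℝ) ≤ 5) ht1 ht2
  have cb := afhfCap_n1_U5_at t' (by norm_num : (0 : ℝ) ≤ 5) le_rfl
  have hcap := objE_capChord_mul (k := 5) (by norm_num : (0 : ℝ) ≤ 5) (by norm_num) (by norm_num) (by norm_num) ca cb hn1 (by linarith) (by norm_num)
  rcases le_or_gt t' (-1 / 2) with hp0 | hp0
  · -- piece `[-27/50, -1/2]`, columns `-113/200`, `-1/2`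
    have ra := fermiSeaRow4_tPrime_neg_hundredthirteen_div_twohundred_at_thirtythree_div_forty (U := 0) le_rfl hn0 hn2'
    have rb := fermiSeaTangentRow_tPrime_neg_one_div_two_at_seven_div_eight (U := 0) le_rfl hn0 hn2'
    have hfl := objE_floorChord_mul (s := t') (k := 200 / 13) hn0 hn2' (by norm_num : (-113 / 200 : ℝ) < -1 / 2) ra rb (by linarith) hp0 (by norm_num)
    exact doccN_lt_of_capUc_threshold (U₁ := 47 / 10) (Uc := 5) (by norm_num) (by norm_num) hU hn0 hn2' hcap hfl
      (by nlinarith only [mul_nonneg (sub_nonneg.2 hn1) (sub_nonneg.2 ht1), mul_nonneg (sub_nonneg.2 hn1) (sub_nonneg.2 hp0), mul_nonneg (sub_nonneg.2 hn2) (sub_nonneg.2 ht1), mul_nonneg (sub_nonneg.2 hn2) (sub_nonneg.2 hp0), hsqU])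
  · -- `t' > -1/2`
    have ra := fermiSeaTangentRow_tPrime_neg_one_div_two_at_seven_div_eight (U := 0) le_rfl hn0 hn2'
    have rb := fermiSeaTangentRow_tPrime_neg_two_div_five_at_seven_div_eight (U := 0) le_rfl hn0 hn2'
    have hfl := objE_floorChord_mul (s := t') (k := 10) hn0 hn2' (by norm_num : (-1 / 2 : ℝ) < -2 / 5) ra rb hp0.le (by linarith) (by norm_num)
    exact doccN_lt_of_capUc_threshold (U₁ := 47 / 10) (Uc := 5) (by norm_num) (by norm_num) hU hn0 hn2' hcap hfl
      (by nlinarith only [mul_nonneg (sub_nonneg.2 hn1) (sub_nonneg.2 hp0.le), mul_nonneg (sub_nonneg.2 hn1) (sub_nonneg.2 ht2), mul_nonneg (sub_nonneg.2 hn2) (sub_nonneg.2 hp0.le), mul_nonneg (sub_nonneg.2 hn2) (sub_nonneg.2 ht2), hsqU])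

/-- **HgBa₂CuO₄₊δ p = 0.16 at P = 10 GPa (first pressure column), object-E box `[3.0, 8.5] × [−0.49, −0.35] × [0.79, 0.88]`, `t' ∈ [-49/100, -7/20]` × `n ∈ [79/100, 22/25]` — MF/BCS class excluded at EVERY `U ≥ 49/10`, HYPOTHESIS-FREE** (box `U/t_eff ∈ [3.0, 8.5]`; supersedes for coverage the conditional `hgP_M19P10_docc_lt (round 1) ⊂ hgE_P10_p016_docc_lt_of (U ≥ 6.5; #445 ∧ #473 ∧ #472)`). Every GS torus limit has `Re ω(n_{0↑}n_{0↓}) < (n/2)²`. Cap at `U_c = 5` = density chord from the polarised-sea plane at `n = 79/100` to the kernel AF-HF half-filling cap `afhfCap_n1_U5_at` (tail: monotone below `U_c`, HF slope above); floor = `t'`-chords of the kernel Fermi-sea columns `-1/2 | -9/20 | -7/20` (touch `7/8 | 7/8 | 7/8`); exact piece margins `+0.0645`, `+0.0194`. [cite: BachLiebSolovej1994, eq. (2c.36)] [cite: KomaTasaki1994, §1] [cite: LiebLoss1993, §8, Theorem 8.2] -/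
theorem hgP_M19P10_docc_lt_v2 {t' U n : ℝ} (ht1 : -49 / 100 ≤ t') (ht2 : t' ≤ -7 / 20) (hU : 49 / 10 ≤ U)
    (hn1 : 79 / 100 ≤ n) (hn2 : n ≤ 22 / 25) :
    ∀ (ω : InfVolFermionState 2) (Ls : ℕ → ℕ) (ψ : ∀ L, Fock (Orb (FermionTorus 2 L))),
      Tendsto Ls atTop atTop →
      (∀ j, IsGroundStateInSector (hubbardTorusTT' (Ls j) 1 t' U) (rectN n (Ls j)) 0 (ψ (Ls j))) →
      (∀ j, star (ψ (Ls j)) ⬝ᵥ ψ (Ls j) = 1) → ω.IsTorusLimitOf ψ Ls →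
      (ω.expect ({0} : Finset (Site 2))
        (nAt 0 (Finset.mem_singleton_self 0) 0 * nAt 0 (Finset.mem_singleton_self 0) 1)).re < (n / 2) ^ 2 := by
  have hn0 : (0 : ℝ) ≤ n := by linarith
  have hn2' : n < 2 := by linarith
  have hsq : (-6241 / 40000 : ℝ) + 79 / 200 * n ≤ (n / 2) ^ 2 := by nlinarith [sq_nonneg (n - 79 / 100)]
  have hsqU : ((-6241 / 40000 : ℝ) + 79 / 200 * n) * (49 / 10) ≤ (n / 2) ^ 2 * (49 / 10) :=
    mul_le_mul_of_nonneg_right hsq (by norm_num)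
  -- CAP at `U_c = 5`: density chord from the polarised-sea plane at `n = 79/100` to the kernel AF-Hartree–Fock half-filling cap
  have ca := hgP19P10_polCap_n7900 (by norm_num : (0 : ℝ) ≤ 5) ht1 ht2
  have cb := afhfCap_n1_U5_at t' (by norm_num : (0 : ℝ) ≤ 5) le_rfl
  have hcap := objE_capChord_mul (k := 100 / 21) (by norm_num : (0 : ℝ) ≤ 5) (by norm_num) (by norm_num) (by norm_num) ca cb hn1 (by linarith) (by norm_num)
  rcases le_or_gt t' (-9 / 20) with hp0 | hp0
  · -- piece `[-49/100, -9/20]`, columns `-1/2`, `-9/20`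
    have ra := fermiSeaTangentRow_tPrime_neg_one_div_two_at_seven_div_eight (U := 0) le_rfl hn0 hn2'
    have rb := fermiSeaTangentRow_tPrime_neg_nine_div_twenty_at_seven_div_eight (U := 0) le_rfl hn0 hn2'
    have hfl := objE_floorChord_mul (s := t') (k := 20) hn0 hn2' (by norm_num : (-1 / 2 : ℝ) < -9 / 20) ra rb (by linarith) hp0 (by norm_num)
    exact doccN_lt_of_capUc_threshold (U₁ := 49 / 10) (Uc := 5) (by norm_num) (by norm_num) hU hn0 hn2' hcap hfl
      (by nlinarith only [mul_nonneg (sub_nonneg.2 hn1) (sub_nonneg.2 ht1), mul_nonneg (sub_nonneg.2 hn1) (sub_nonneg.2 hp0), mul_nonneg (sub_nonneg.2 hn2) (sub_nonneg.2 ht1), mul_nonneg (sub_nonneg.2 hn2) (sub_nonneg.2 hp0), hsqU])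
  · -- `t' > -9/20`
    have ra := fermiSeaTangentRow_tPrime_neg_nine_div_twenty_at_seven_div_eight (U := 0) le_rfl hn0 hn2'
    have rb := fermiSeaTangentRow_tPrime_neg_seven_div_twenty_at_seven_div_eight (U := 0) le_rfl hn0 hn2'
    have hfl := objE_floorChord_mul (s := t') (k := 10) hn0 hn2' (by norm_num : (-9 / 20 : ℝ) < -7 / 20) ra rb hp0.le ht2 (by norm_num)
    exact doccN_lt_of_capUc_threshold (U₁ := 49 / 10) (Uc := 5) (by norm_num) (by norm_num) hU hn0 hn2' hcap hfl
      (by nlinarith only [mul_nonneg (sub_nonneg.2 hn1) (sub_nonneg.2 hp0.le), mul_nonneg (sub_nonneg.2 hn1) (sub_nonneg.2 ht2), mul_nonneg (sub_nonneg.2 hn2) (sub_nonneg.2 hp0.le), mul_nonneg (sub_nonneg.2 hn2) (sub_nonneg.2 ht2), hsqU])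

end Summit.Ventures.CertifiedManyBodySolver.Observables

end
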